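import Summits.ABC.IUTFork.Cor312PinnedIndTrivialBeds5
import Summits.ABC.IUTFork.Cor312PinnedIndTrivialUnitLaw
import Summits.ABC.IUTFork.Cor312PinnedIndTrivialPermLaw
import Summits.ABC.IUTFork.Cor312PinnedIndTrivialScalarOrbit
import HarnessLib

/-!
# [IUTchIII] Cor. 3.12 — over the SIGN shells the hull `ⁿ˒°𝒰`, the (xi-f) Licence, the hull target `S_H` and the residual `S` read ONE reflection

Proof-only junction file (D-0012; NO definition, NO `Prop` fact) of the abc-iut cell (WAVE-5 prover abc-iut-w5-d068, gen 5), sequel of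
`Cor312PinnedIndTrivialBeds5` §7 (THE SIGN LAW `indTrivial_iff_flip_stable_signShells`, `possibleImages_eq_pair_signShells`: over abc-iut-w5-d247's
sign shells the possible images of the Θ-pilot at every packet are EXACTLY the pair `{A, −A}`, `A = thetaRegion3`) and companion of
`Cor312PinnedIndTrivialOrbitReadings` (unit / split shells) and `Cor312PinnedIndTrivialScalarOrbit` (scalar shells). TAKES NO SIDE on [IUTchIII]
Cor. 3.12 or on any author; toy carriers; instantiated ≠ endorsed.

Here the pair law is pushed through the four nouns of the (xi-f) edge of the frozen Corollary — for EVERY setting over ANY situation `⟨signShells, D, G⟩`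
(no (Ind)-triviality hypothesis; compare the parent `Cor312PinnedIndTrivial` §1, which needs it):
* `thetaHull_signShells` — the holomorphic hull `ⁿ˒°𝒰_{j,v_ℚ}` ([IUTchIII] Cor. 3.12, p. 174 l. 1–11; Rmk. 3.9.5) is the FRAME-HULL of `A ∪ −A`;
  `hullDefined_iff_signShells` — `HullDefined` reads boundedness / hull-admission of `A ∪ −A`;
* `licence_iff_signShells` — abc-iut-c312-2's (xi-f) `Thm311ToCor312.Licence` reads «q-region ⊆ frame-hull(A ∪ −A)» at every label of `𝔽_l^⋇`;
* `pilotKummerCompatHull_iff_signShells` — this seat's hull target `S_H = Cor312Vol.PilotKummerCompatHull` (p420303) reads «`ρ qK ⊆ frame-hull(A ∪ −A)`»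
  at every packet (any column structure `col`, any region operator `ρ`, any q-datum `qK`);
* `thetaHull_signShells_of_symmetric` / `licence_iff_signShells_of_symmetric` — for centrally symmetric Θ-regions (the (Ind)-TRIVIAL sign beds) the
  reflection disappears and the parent's (Ind)-trivial formulas `hull(A)` are recovered WITHOUT the closure hypothesis;
* **`residual_iff_signShells`** — under Thm. 3.11 (ii)(b) for the column and the two region pins, abc-iut-w5-d230's residual `S = PilotKummerIndRelated`
  READS «at every packet the q-pilot region is the Θ-region OR ITS REFLECTION» — P♮'s `halfNeg = −halfPos` is the second disjunct, the (Ind)-trivial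
  beds' bare identification (= Team R's reading there, parent §2) the first.
* §2 **`indTriviality_laws`** — THE FIVE LAWS OF THE LEDGER, PACKAGED under one name for citation (abc-iut-rp-plan RP-C03 / §J): GENERATOR (any
  situation) · SIGN (central symmetry) · UNIT (unit-stability) · SCALAR (U-stability; with ball glue: `U` ≤ `p`-adic units) · PERMUTATION
  (capsule-permutation stability) — `Cor312PinnedIndTrivialBeds5` §4/§6/§7, `…UnitLaw`, `…ScalarOrbit`, `…PermLaw`, nothing re-proved.
So over the sign shells the entire (Ind1)/(Ind2)-content of the (xi-f) edge is the single reflection `A ↦ −A`. Consumed BY NAME (`Setting.thetaHull` /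
`HullDefined` / `Thm311ToCor312.Licence` / `PilotKummerCompatHull` / `PilotKummerIndRelated` unfolded or read through `reading3_iff_pilotKummerIndRelated`,
nothing restated); standard axioms; typed ≠ proved. [claim: Mochizuki2012, status: disputed] [cite: ScholzeStix2018, §2.2 pp. 9–10]
-/

noncomputable section

open Set

namespace Summit.ABC.IUTFork.Cor312Vol.IndTrivial

open Thm311 Cor312 Cor312.IdentifiedNonVacuity Cor312Vol NaiveWitness NaturalWitness SplitWitness Literature.IUT.LogThetaLattice

/-! ## 1. Sign shells: everything reads one reflection -/

section SignShells

variable (D : ℤ → MRData signShells) (G : ∀ (n : ℤ) (j : Checks.toyIndex.LabelStar), GlobalDegrees signShells j)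
  (P : Cor312.Setting (⟨signShells, D, G⟩ : Situation Checks.toyIndex))

/-- **The holomorphic hull over the sign shells is the frame-hull of `A ∪ −A`** (`A = thetaRegion3`), for EVERY setting over any situation
`⟨signShells, D, G⟩` — by the pair law `possibleImages_eq_pair_signShells`. [claim: Mochizuki2012, status: disputed] -/
theorem thetaHull_signShells (j : Checks.toyIndex.Label) (vQ : Checks.toyIndex.VQ) :
    P.thetaHull j vQ = (P.frame j vQ).hull (P.thetaRegion3 j vQ ∪ flipFamily j vQ '' P.thetaRegion3 j vQ) := by
  unfold Setting.thetaHull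
  rw [sUnion_possibleImages_signShells D G P j vQ]

/-- `HullDefined` over the sign shells reads: `A ∪ −A` is relatively compact and admits a hull. [folklore] -/
theorem hullDefined_iff_signShells (j : Checks.toyIndex.Label) (vQ : Checks.toyIndex.VQ) :
    P.HullDefined j vQ ↔
      (P.frame j vQ).IsBounded (P.thetaRegion3 j vQ ∪ flipFamily j vQ '' P.thetaRegion3 j vQ) ∧
        (P.frame j vQ).HasHull (P.thetaRegion3 j vQ ∪ flipFamily j vQ '' P.thetaRegion3 j vQ) := by
  unfold Setting.HullDefined
  rw [sUnion_possibleImages_signShells D G P j vQ]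

/-- **The (xi-f) Licence over the sign shells** (abc-iut-c312-2's `Thm311ToCor312.Licence`): at every label of `𝔽_l^⋇` the q-pilot region lies in the
frame-hull of `A ∪ −A`. [claim: Mochizuki2012, status: disputed] -/
theorem licence_iff_signShells :
    Thm311ToCor312.Licence P ↔
      ∀ (i : Fin Checks.toyIndex.lstar) (vQ : Checks.toyIndex.VQ),
        P.qRegion (Setting.labelSucc i) vQ ⊆
          (P.frame _ vQ).hull (P.thetaRegion3 (Setting.labelSucc i) vQ ∪ flipFamily _ vQ '' P.thetaRegion3 (Setting.labelSucc i) vQ) := by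
  refine forall₂_congr fun i vQ => ?_
  rw [thetaHull_signShells D G P]

/-- **The hull target `S_H` over the sign shells** (this seat's `Cor312Vol.PilotKummerCompatHull`, p420303; any column structure `col`, any region
operator `ρ`, any q-pilot Kummer datum `qK`): «`ρ qK ⊆ frame-hull(A ∪ −A)`» at every packet. [claim: Mochizuki2012, status: disputed] -/
theorem pilotKummerCompatHull_iff_signShells (col : ℤ → Column signShells)
    (ρ : (∀ v : Checks.toyIndex.V, v ∈ Checks.toyIndex.Vbad → Set (signShells.StarPacket v)) →
      ∀ (j : Checks.toyIndex.Label) (vQ : Checks.toyIndex.VQ), Set (signShells.Packet j vQ))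
    (qK : ∀ v : Checks.toyIndex.V, v ∈ Checks.toyIndex.Vbad → Set (signShells.StarPacket v)) :
    PilotKummerCompatHull (⟨⟨signShells, D, G⟩, col⟩ : LatticeSituation Checks.toyIndex) P ρ qK ↔
      ∀ (j : Checks.toyIndex.Label) (vQ : Checks.toyIndex.VQ),
        ρ qK j vQ ⊆ (P.frame j vQ).hull (P.thetaRegion3 j vQ ∪ flipFamily j vQ '' P.thetaRegion3 j vQ) := by
  refine forall₂_congr fun j vQ => ?_
  rw [thetaHull_signShells D G P]

/-- **Symmetric Θ-regions: the reflection disappears.** If every (Ind3)-enlarged Θ-region is centrally symmetric (the (Ind)-TRIVIAL sign beds,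
`indTrivial_iff_flip_stable_signShells`), the hull is the frame-hull of `A` itself — the parent's `thetaHull_eq`, closure-free. [folklore] -/
theorem thetaHull_signShells_of_symmetric
    (hsym : ∀ (j : Checks.toyIndex.Label) (vQ : Checks.toyIndex.VQ), flipFamily j vQ '' P.thetaRegion3 j vQ = P.thetaRegion3 j vQ)
    (j : Checks.toyIndex.Label) (vQ : Checks.toyIndex.VQ) : P.thetaHull j vQ = (P.frame j vQ).hull (P.thetaRegion3 j vQ) := by
  rw [thetaHull_signShells D G P, hsym j vQ, Set.union_self]

/-- … and the (xi-f) Licence is then PURE FRAME INFLATION «q-region ⊆ frame-hull(Θ-region)» (the parent's `licence_iff`, closure-free).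
[claim: Mochizuki2012, status: disputed] -/
theorem licence_iff_signShells_of_symmetric
    (hsym : ∀ (j : Checks.toyIndex.Label) (vQ : Checks.toyIndex.VQ), flipFamily j vQ '' P.thetaRegion3 j vQ = P.thetaRegion3 j vQ) :
    Thm311ToCor312.Licence P ↔
      ∀ (i : Fin Checks.toyIndex.lstar) (vQ : Checks.toyIndex.VQ),
        P.qRegion (Setting.labelSucc i) vQ ⊆ (P.frame _ vQ).hull (P.thetaRegion3 (Setting.labelSucc i) vQ) := by
  refine forall₂_congr fun i vQ => ?_
  rw [thetaHull_signShells_of_symmetric D G P hsym]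

/-- **THE RESIDUAL OVER THE SIGN SHELLS READS ONE REFLECTION.** Under Thm. 3.11 (ii) (b) for the column (`KummerB`) and the two region pins of the
Corollary's statement, abc-iut-w5-d230's residual `S = PilotKummerIndRelated` holds iff at every packet the q-pilot region is the Θ-region OR ITS
REFLECTION (`reading3_iff_pilotKummerIndRelated`: S ⟺ «q-region is a possible image»; `possibleImages_eq_pair_signShells`). First disjunct everywhere
= the bare identification of the (Ind)-trivial beds (= Team R's reading there, parent §2); the second disjunct is how P♮ / P♮⁺ / CV / P♮_β satisfy `S`
(`halfNeg = −halfPos`). [claim: Mochizuki2012, status: disputed] -/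
theorem residual_iff_signShells (col : ℤ → Column signShells)
    (ρ : (∀ v : Checks.toyIndex.V, v ∈ Checks.toyIndex.Vbad → Set (signShells.StarPacket v)) →
      ∀ (j : Checks.toyIndex.Label) (vQ : Checks.toyIndex.VQ), Set (signShells.Packet j vQ))
    (qK : ∀ v : Checks.toyIndex.V, v ∈ Checks.toyIndex.Vbad → Set (signShells.StarPacket v))
    (hKumB : (col P.n).KummerB (D P.n)) (hpin : PinnedRegions (⟨⟨signShells, D, G⟩, col⟩ : LatticeSituation Checks.toyIndex) P ρ qK) :
    PilotKummerIndRelated (⟨⟨signShells, D, G⟩, col⟩ : LatticeSituation Checks.toyIndex) P ρ qK ↔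
      ∀ (j : Checks.toyIndex.Label) (vQ : Checks.toyIndex.VQ),
        P.qRegion j vQ = P.thetaRegion3 j vQ ∨ P.qRegion j vQ = flipFamily j vQ '' P.thetaRegion3 j vQ := by
  rw [← reading3_iff_pilotKummerIndRelated (⟨⟨signShells, D, G⟩, col⟩ : LatticeSituation Checks.toyIndex) P ρ qK hKumB hpin]
  refine forall₂_congr fun j vQ => ?_
  rw [possibleImages_eq_pair_signShells D G P j vQ, Set.mem_insert_iff, Set.mem_singleton_iff]

end SignShells


/-! ## 2. The five laws of the (Ind)-triviality ledger, packaged -/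

/-- **THE FIVE LAWS, PACKAGED.** (1) GENERATOR LAW (any situation): (Ind)-trivial ⟺ every (Ind1)- or (Ind2)-family fixes every Θ-region;
(2) SIGN LAW (abc-iut-w5-d247's sign shells): ⟺ every Θ-region is centrally symmetric; (3) UNIT LAW (abc-iut-w4-d101's unit shells): ⟺ every Θ-region
is stable under every `p`-adic unit; (4) SCALAR LAW (abc-iut-w4-d098's scalar shells, glue-free form): ⟺ every Θ-region is `U`-stable — with ball glue
⟺ every scalar of `U` is a `p`-adic unit; (5) PERMUTATION LAW (abc-iut-w5-d230's split shells): ⟺ every Θ-region is stable under every capsule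
permutation. One name for abc-iut-rp-plan's engine row; each conjunct is the landed theorem, nothing re-proved. [folklore] -/
theorem indTriviality_laws (p : ℕ) [Fact p.Prime] (U : Subgroup ℚˣ) :
    (∀ {T : ThetaIndex} (S₀ : Situation T) (P : Cor312.Setting S₀),
        (∀ Φ ∈ Setting.indGroup S₀, ∀ (j : T.Label) (vQ : T.VQ), Φ j vQ '' P.thetaRegion3 j vQ = P.thetaRegion3 j vQ) ↔
          ∀ Φ ∈ S₀.L.Ind1Family ∪ S₀.L.Ind2Family, ∀ (j : T.Label) (vQ : T.VQ), Φ j vQ '' P.thetaRegion3 j vQ = P.thetaRegion3 j vQ) ∧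
      (∀ (D : ℤ → MRData signShells) (G : ∀ (n : ℤ) (j : Checks.toyIndex.LabelStar), GlobalDegrees signShells j)
          (P : Cor312.Setting (⟨signShells, D, G⟩ : Situation Checks.toyIndex)),
        (∀ Φ ∈ Setting.indGroup (⟨signShells, D, G⟩ : Situation Checks.toyIndex), ∀ (j : Checks.toyIndex.Label) (vQ : Checks.toyIndex.VQ),
            Φ j vQ '' P.thetaRegion3 j vQ = P.thetaRegion3 j vQ) ↔
          ∀ (j : Checks.toyIndex.Label) (vQ : Checks.toyIndex.VQ), flipFamily j vQ '' P.thetaRegion3 j vQ = P.thetaRegion3 j vQ) ∧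
      (∀ (D : ℤ → MRData (UnitWitness.unitShells p)) (G : ∀ (n : ℤ) (j : Checks.toyIndex.LabelStar), GlobalDegrees (UnitWitness.unitShells p) j)
          (P : Cor312.Setting (⟨UnitWitness.unitShells p, D, G⟩ : Situation Checks.toyIndex)),
        (∀ Φ ∈ Setting.indGroup (⟨UnitWitness.unitShells p, D, G⟩ : Situation Checks.toyIndex),
            ∀ (j : Checks.toyIndex.Label) (vQ : Checks.toyIndex.VQ), Φ j vQ '' P.thetaRegion3 j vQ = P.thetaRegion3 j vQ) ↔
          ∀ c : ℚ, UnitWitness.IsPUnit p c → ∀ (j : Checks.toyIndex.Label) (vQ : Checks.toyIndex.VQ),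
            (fun x => c • x) '' P.thetaRegion3 j vQ = P.thetaRegion3 j vQ) ∧
      (∀ (D : ℤ → MRData (Repair.ScalarShells.scalarShells p U))
          (G : ∀ (n : ℤ) (j : Checks.toyIndex.LabelStar), GlobalDegrees (Repair.ScalarShells.scalarShells p U) j)
          (P : Cor312.Setting (⟨Repair.ScalarShells.scalarShells p U, D, G⟩ : Situation Checks.toyIndex)),
        ((∀ Φ ∈ Setting.indGroup (⟨Repair.ScalarShells.scalarShells p U, D, G⟩ : Situation Checks.toyIndex),
            ∀ (j : Checks.toyIndex.Label) (vQ : Checks.toyIndex.VQ), Φ j vQ '' P.thetaRegion3 j vQ = P.thetaRegion3 j vQ) ↔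
          ∀ u : ℚˣ, u ∈ U → ∀ (j : Checks.toyIndex.Label) (vQ : Checks.toyIndex.VQ),
            (fun x => (u : ℚ) • x) '' P.thetaRegion3 j vQ = P.thetaRegion3 j vQ) ∧
        ((∀ (j : Checks.toyIndex.Label) (vQ : Checks.toyIndex.VQ), ∃ k : ℤ, P.thetaRegion3 j vQ = Repair.ScalarShells.sBall p U j vQ k) →
          ((∀ Φ ∈ Setting.indGroup (⟨Repair.ScalarShells.scalarShells p U, D, G⟩ : Situation Checks.toyIndex),
              ∀ (j : Checks.toyIndex.Label) (vQ : Checks.toyIndex.VQ), Φ j vQ '' P.thetaRegion3 j vQ = P.thetaRegion3 j vQ) ↔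
            ∀ u : ℚˣ, u ∈ U → padicValRat p (u : ℚ) = 0))) ∧
      ∀ (D : ℤ → MRData splitShells) (G : ∀ (n : ℤ) (j : splitIndex.LabelStar), GlobalDegrees splitShells j)
          (P : Cor312.Setting (⟨splitShells, D, G⟩ : Situation splitIndex)),
        (∀ Φ ∈ Setting.indGroup (⟨splitShells, D, G⟩ : Situation splitIndex), ∀ (j : splitIndex.Label) (vQ : splitIndex.VQ),
            Φ j vQ '' P.thetaRegion3 j vQ = P.thetaRegion3 j vQ) ↔
          ∀ (j : splitIndex.Label) (vQ : splitIndex.VQ) (σ : Equiv.Perm (splitIndex.Caps j)),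
            splitShells.permute j vQ σ '' P.thetaRegion3 j vQ = P.thetaRegion3 j vQ :=
  ⟨fun S₀ P => indTrivial_iff_generators S₀ P, fun D G P => indTrivial_iff_flip_stable_signShells D G P,
    fun D G P => indTrivial_iff_units_stable p D G P,
    fun D G P => ⟨indTrivial_iff_scalars_stable p U D G P, fun hball => indTrivial_iff_scalars_padicUnits p U D G P hball⟩,
    fun D G P => indTrivial_iff_perm_stable_splitShells D G P⟩


end Summit.ABC.IUTFork.Cor312Vol.IndTrivial

end
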